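/-
Copyright (c) 2026 the pub-hodgecm-mathlib formalisation cell (harness21).  Prover seat hodgecm-mathlib-B-p04 (g35), heir of the (R2) EP pen — (S8) «(N)-ram
assembly» after A-p06 (g27)'s recipe 2026-09-01T10:08Z, 2026-09-01.
-/
import Literature.NumberTheory.Automorphic.HermitianLatticeTreePeriodCount       -- ★ A-p06 (g27) (S7b): `natCard_quotient_fixed_add_eq_natCard_quotient_fixedFlags'`, `latticeTreePerm_zpow`
import Literature.NumberTheory.Automorphic.HermitianLatticeTreeFixedDictionary   -- ★ A-p17 (g22) (S6): the coset ↔ vertex dictionaries with values, `dictionary_equivariant`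
import Literature.NumberTheory.Automorphic.UnitaryUnitOrbitalIntegralLatticeCount -- ★ `exists_equiv_fixedBy_quotient_congr` (fixed cosets along a model `G ≃* U`)
import HarnessLib

/-!
# Per-period fixed-coset counts of `U(Φ₂)` at a diagonal torus element = per-period fixed-vertex counts of its tree; hence
# `#(Fix(U⧸K)∕τ^ℤ) + #(Fix(U⧸K′)∕τ^ℤ) = #(Fix(U⧸(K ⊓ K′))∕τ^ℤ)` (Kottwitz 1988 §2; Serre, *Trees* I.6.4, II.1.1)

Topic `NumberTheory/Automorphic`; namespace `Literature.NumberTheory.Automorphic.HermitianLatticeTree`.  THEOREMS ONLY (no definition, no instance, no notation,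
no named fact, no `sorry`); kernel lane.  Cell `pub/hodgecm-mathlib` (D-0151), crux H413 (`stmt-HodgeConjecture-24833`), line «N6nsGerm», (R2) Euler–Poincaré road,
RAMIFIED half, brick (S8) of A-p06 (g27)'s census (the NON-ELLIPTIC relation (N) per period of the split torus): the COSET side of ★ (S7b)
`natCard_quotient_fixed_add_eq_natCard_quotient_fixedFlags'`.  HONEST LABEL: HC_CM is proved only modulo the cell's remaining named inputs (hLiu418, h413) until
rung 0 closes; nothing printed is asserted here — orbit counting through equivariant bijections.

THE MATHEMATICS.  `U = U(σ, Φ)`, `Φ = antidiag(1,1)`, over a discretely valued field; `K = U ∩ GL₂(𝒪)`, `K′ = U ∩ g₁GL₂(𝒪)g₁⁻¹`, `I = K ⊓ K′` (the three facet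
stabilisers of the base edge `(𝒪², latt g₁)`); `γ ∈ U`; `τ ∈ U` commuting with `γ`, acting on `U ⧸ C` by left translation and on the tree by `perm τ`.  ★ (S6) gives
bijections `Fix_γ(U⧸K) ≃ F_A` (fixed self-dual vertices), `Fix_γ(U⧸K′) ≃ F_B` (fixed `ϖ`-modular vertices), `Fix_γ(U⧸I) ≃ Fl` (fixed flags) with EXPLICIT values
`uC ↦ latt u`, `latt (u g₁)`, `(latt u, latt (u g₁))`; by ★ `dictionary_equivariant` they intertwine `τ^ℤ` on cosets with `(perm τ)^ℤ` on vertices, so the PER-PERIOD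
counts agree (§1–§2: a bijection matching two equivalence relations matches the quotients).  Summing, ★ (S7b) (`γ` diagonal with unit entries, `τ = diag(ϖ, (σϖ)⁻¹)`)
gives `#(Fix(U⧸K)∕τ^ℤ) + #(Fix(U⧸K′)∕τ^ℤ) = #(Fix(U⧸I)∕τ^ℤ)` — the three terms Kottwitz's non-elliptic relation (N) compares after ★
`classOrbitalIntegral_indicator_complex_eq_mul_natCard_quotient_zpowers` (`ν(C)⁻¹ Φ(⟦γ⟧, 𝟙_C) = #(Fix(U⧸C)∕τ^ℤ)`).

* §1 `natCard_quotient_comap_eq_of_equiv` — `#(A∕R) = #(B∕R′)` (and `Finite ↔ Finite`) for `f : A ≃ B` matching `R` on `ι a` with `R′` on `ι′ (f a)`.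
* §2 **`natCard_quotient_orbitRel_fixedBy_eq_of_dictionary`** — per level: `#(Fix_γ(U⧸C)∕τ^ℤ) = #(S∕(perm τ)^ℤ)` for an equivariant dictionary `Fix_γ(U⧸C) ≃ S`.
* §3 the three levels `natCard_quotient_orbitRel_fixedBy_glInt_eq` ∕ `…_conj_eq` ∕ `…_inf_eq` and the sum
  **`natCard_quotient_fixedBy_add_eq_natCard_quotient_fixedBy_inf`**.

## References
* [Kottwitz1988] R. E. Kottwitz, *Tamagawa numbers*, Ann. of Math. 127 (1988), 629–646, §2 Theorem 2.
* [Serre1980Trees] J.-P. Serre, *Trees* (1980), Ch. I §6.4 (quotients by an automorphism group), Ch. II §1.1.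
* [Laumon1995] G. Laumon, *Cohomology of Drinfeld Modular Varieties* I (1996), Lemma (5.3.2).
-/

set_option autoImplicit false

noncomputable section

open scoped ValuativeRel Matrix MatrixGroups
open Matrix ValuativeRel MulAction

namespace Literature.NumberTheory.Automorphic.HermitianLatticeTree

open Literature.NumberTheory.Automorphic

/-! ## §1 Quotient counts along a relation-matching bijection -/

section Transfer

/-- **`#(A∕R) = #(B∕R′)` along a bijection matching the relations**: for `f : A ≃ B` with `R (ι a) (ι a′) ↔ R′ (ι′ (f a)) (ι′ (f a′))`, the quotients of `A` by
`R.comap ι` and of `B` by `R′.comap ι′` are in bijection; in particular they have the same `Nat.card` and one is finite iff the other is. [cite: Serre1980Trees, I.6.4] -/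
theorem natCard_quotient_comap_eq_of_equiv {A B X Y : Type*} (R : Setoid X) (R' : Setoid Y) (ι : A → X) (ι' : B → Y) (f : A ≃ B)
    (h : ∀ a a' : A, R (ι a) (ι a') ↔ R' (ι' (f a)) (ι' (f a'))) :
    Nat.card (Quotient (R.comap ι)) = Nat.card (Quotient (R'.comap ι')) ∧ (Finite (Quotient (R.comap ι)) ↔ Finite (Quotient (R'.comap ι'))) := by
  let F : Quotient (R.comap ι) → Quotient (R'.comap ι') := Quotient.map f fun a a' hab => by
    have hab' : (R.comap ι) a a' := hab
    rw [Setoid.comap_rel] at hab'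
    show (R'.comap ι') (f a) (f a')
    rw [Setoid.comap_rel]
    exact (h a a').1 hab'
  have hF : Function.Bijective F := by
    refine ⟨fun p q hpq => ?_, fun q => ?_⟩
    · induction p using Quotient.inductionOn with
      | h a =>
        induction q using Quotient.inductionOn with
        | h a' =>
          have h1 : (R'.comap ι') (f a) (f a') := Quotient.exact hpq
          rw [Setoid.comap_rel] at h1
          refine Quotient.sound ?_
          show (R.comap ι) a a'
          rw [Setoid.comap_rel]
          exact (h a a').2 h1
    · induction q using Quotient.inductionOn with
      | h b => exact ⟨Quotient.mk _ (f.symm b), by change Quotient.mk _ (f (f.symm b)) = _; rw [Equiv.apply_symm_apply]⟩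
  exact ⟨Nat.card_eq_of_bijective F hF, ⟨fun _ => Finite.of_surjective F hF.2, fun _ => Finite.of_injective F hF.1⟩⟩

end Transfer

/-! ## §2 One level: fixed cosets per period of `τ` = dictionary images per period of a permutation `p` -/

section Level

variable {G : Type*} [Group G] {W Y : Type*} [MulAction (Equiv.Perm W) Y]

/-- **PER-PERIOD DICTIONARY, ONE LEVEL** (pure group theory).  `C ≤ G`, `γ, τ ∈ G` commuting, `p` a permutation of some type `W` acting on `Y`, and a dictionary
`e : Fix_γ(G ⧸ C) ≃ {y // P y}` which is `τ`-EQUIVARIANT: the value at `(τ^n u) C` is `p^n` applied to the value at `u C`.  Then the number of `τ^ℤ`-orbits on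
`Fix_γ(G ⧸ C)` (the per-period count of ★ `classOrbitalIntegral_indicator_complex_eq_mul_natCard_quotient_zpowers`) equals the number of `p^ℤ`-orbits on `{y // P y}`,
and one is finite iff the other is. [cite: Serre1980Trees, I.6.4] [cite: Kottwitz1988, §2] -/
theorem natCard_quotient_orbitRel_fixedBy_eq_of_equivariant (C : Subgroup G) (γ τ : G) (hτ : τ * γ = γ * τ) (p : Equiv.Perm W) {P : Y → Prop}
    (e : ↥(fixedBy (G ⧸ C) γ) ≃ {y // P y})
    (he : ∀ (x x' : ↥(fixedBy (G ⧸ C) γ)) (n : ℤ) (u : G), (x : G ⧸ C) = (u : G ⧸ C) → (x' : G ⧸ C) = ((τ ^ n * u : G) : G ⧸ C) →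
      ((e x' : {y // P y}) : Y) = (p ^ n) • ((e x : {y // P y}) : Y)) :
    Nat.card (Quotient ((orbitRel (Subgroup.zpowers (⟨τ, Subgroup.mem_centralizer_singleton_iff.2 hτ⟩ : Subgroup.centralizer ({γ} : Set G))) (G ⧸ C)).comap
        (Subtype.val : ↥(fixedBy (G ⧸ C) γ) → G ⧸ C))) =
      Nat.card (Quotient ((orbitRel (Subgroup.zpowers p) Y).comap (Subtype.val : {y // P y} → Y))) ∧
    (Finite (Quotient ((orbitRel (Subgroup.zpowers (⟨τ, Subgroup.mem_centralizer_singleton_iff.2 hτ⟩ : Subgroup.centralizer ({γ} : Set G))) (G ⧸ C)).comap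
        (Subtype.val : ↥(fixedBy (G ⧸ C) γ) → G ⧸ C))) ↔
      Finite (Quotient ((orbitRel (Subgroup.zpowers p) Y).comap (Subtype.val : {y // P y} → Y)))) := by
  refine natCard_quotient_comap_eq_of_equiv _ _ Subtype.val Subtype.val e fun x x' => ?_
  rw [orbitRel_apply, mem_orbit_iff, orbitRel_apply, mem_orbit_iff]
  -- a representative of the coset `x'`
  obtain ⟨u', hu'⟩ := QuotientGroup.mk_surjective (x' : G ⧸ C)
  have hsmul : ∀ n : ℤ, (τ ^ n : G) • (x' : G ⧸ C) = ((τ ^ n * u' : G) : G ⧸ C) := fun n => by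
    rw [← hu', MulAction.Quotient.smul_coe, smul_eq_mul]
  have hcoe : ∀ n : ℤ, (((⟨τ, Subgroup.mem_centralizer_singleton_iff.2 hτ⟩ : Subgroup.centralizer ({γ} : Set G)) ^ n :
      Subgroup.centralizer ({γ} : Set G)) : G) = τ ^ n := fun n => by
    rw [SubgroupClass.coe_zpow, Subgroup.coe_mk]
  constructor
  · rintro ⟨φ, hφ⟩
    obtain ⟨n, hn⟩ := Subgroup.mem_zpowers_iff.1 φ.2
    -- `x = τ^n · x' = (τ^n u') C`
    have hφ' : (((φ : Subgroup.centralizer ({γ} : Set G)) : G)) • (x' : G ⧸ C) = (x : G ⧸ C) := hφ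
    rw [← hn, hcoe n, hsmul n] at hφ'
    have hpn : p ^ n ∈ Subgroup.zpowers p := Subgroup.zpow_mem _ (Subgroup.mem_zpowers p) n
    refine ⟨⟨p ^ n, hpn⟩, ?_⟩
    change (p ^ n) • ((e x' : {y // P y}) : Y) = ((e x : {y // P y}) : Y)
    exact (he x' x n u' hu'.symm hφ'.symm).symm
  · rintro ⟨φ, hφ⟩
    obtain ⟨n, hn⟩ := Subgroup.mem_zpowers_iff.1 φ.2
    -- the candidate `τ^n · x'` is again `γ`-fixed
    have hmem : (τ ^ n : G) • (x' : G ⧸ C) ∈ fixedBy (G ⧸ C) γ := by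
      rw [MulAction.mem_fixedBy, smul_smul, ((Commute.symm (hτ : Commute τ γ)).zpow_right n).eq, ← smul_smul, MulAction.mem_fixedBy.1 x'.2]
    have hφ' : (φ : Equiv.Perm W) • ((e x' : {y // P y}) : Y) = ((e x : {y // P y}) : Y) := hφ
    have hex : e ⟨_, hmem⟩ = e x := by
      apply Subtype.ext
      rw [he x' ⟨_, hmem⟩ n u' hu'.symm (hsmul n), ← hφ', ← hn]
    have hxeq : (⟨_, hmem⟩ : ↥(fixedBy (G ⧸ C) γ)) = x := e.injective hex
    have hτn : (⟨τ, Subgroup.mem_centralizer_singleton_iff.2 hτ⟩ : Subgroup.centralizer ({γ} : Set G)) ^ n ∈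
        Subgroup.zpowers (⟨τ, Subgroup.mem_centralizer_singleton_iff.2 hτ⟩ : Subgroup.centralizer ({γ} : Set G)) :=
      Subgroup.zpow_mem _ (Subgroup.mem_zpowers _) n
    refine ⟨⟨_, hτn⟩, ?_⟩
    change ((((⟨τ, Subgroup.mem_centralizer_singleton_iff.2 hτ⟩ : Subgroup.centralizer ({γ} : Set G)) ^ n : Subgroup.centralizer ({γ} : Set G)) : G)) •
      (x' : G ⧸ C) = (x : G ⧸ C)
    rw [hcoe n, ← congrArg Subtype.val hxeq]

end Level

/-! ## §3 The three levels of `U(Φ)`, read on any model `eU : G ≃* U(Φ)` -/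

section Levels

variable {E : Type*} [Field E] [ValuativeRel E] (σ : E →+* E) (hσv : ∀ x : E, valuation E (σ x) = valuation E x) {ϖ : E} (hϖ : IsUniformizingElement ϖ)
  {G : Type*} [Group G] (eU : G ≃* ↥(unitaryGroupOfForm σ (!![0, 1; 1, 0] : Matrix (Fin 2) (Fin 2) E)))

/-- The permutation `perm (eU τ)^n` moves the vertex `latt (eU u * g₁)` to `latt (eU (τ^n u) * g₁)`. [cite: Serre1980Trees, II.1.1] -/
theorem latticeTreePerm_zpow_smul_coe_eq (g₁ : GL (Fin 2) E) (τ u : G) (n : ℤ)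
    (v : {M : Submodule 𝒪[E] (Fin 2 → E) // IsSpecialLattice σ ϖ (!![0, 1; 1, 0] : Matrix (Fin 2) (Fin 2) E) M})
    (hv : (v : Submodule 𝒪[E] (Fin 2 → E)) = latt ((((eU u : ↥(unitaryGroupOfForm σ (!![0, 1; 1, 0] : Matrix (Fin 2) (Fin 2) E))) : GL (Fin 2) E) * g₁ : GL (Fin 2) E) : Matrix (Fin 2) (Fin 2) E)) :
    (((latticeTreePerm σ ϖ (!![0, 1; 1, 0] : Matrix (Fin 2) (Fin 2) E) (eU τ) ^ n) • v :
        {M : Submodule 𝒪[E] (Fin 2 → E) // IsSpecialLattice σ ϖ (!![0, 1; 1, 0] : Matrix (Fin 2) (Fin 2) E) M}) : Submodule 𝒪[E] (Fin 2 → E)) =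
      latt ((((eU (τ ^ n * u) : ↥(unitaryGroupOfForm σ (!![0, 1; 1, 0] : Matrix (Fin 2) (Fin 2) E))) : GL (Fin 2) E) * g₁ : GL (Fin 2) E) : Matrix (Fin 2) (Fin 2) E) := by
  rw [← latticeTreePerm_zpow, ← map_zpow, Equiv.Perm.smul_def, map_mul, ← mapGL_coe_latt_mul σ (eU (τ ^ n)) (eU u) g₁, ← hv]
  rfl

/-- **LEVEL `K = U ∩ GL₂(𝒪)` (self-dual vertices)**: on a model `eU : G ≃* U(Φ)` with `C ↔ GL₂(𝒪)`, for `γ, τ ∈ G` commuting, the `τ^ℤ`-orbits on `Fix_γ(G ⧸ C)`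
are equinumerous with the `(perm (eU τ))^ℤ`-orbits on the `eU γ`-fixed self-dual vertices (★ (S6) dictionary (A′), τ-equivariant), finiteness included.
[cite: Kottwitz1988, §2] [cite: Serre1980Trees, I.6.4, II.1.1] -/
theorem natCard_quotient_orbitRel_fixedBy_eq_selfDual (C : Subgroup G)
    (hC : ∀ g : G, g ∈ C ↔ ((eU g : ↥(unitaryGroupOfForm σ (!![0, 1; 1, 0] : Matrix (Fin 2) (Fin 2) E))) : GL (Fin 2) E) ∈ glInt 2 E)
    (hA : ∀ M : Submodule 𝒪[E] (Fin 2 → E), IsSelfDualLattice σ (!![0, 1; 1, 0] : Matrix (Fin 2) (Fin 2) E) M →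
      ∃ u : ↥(unitaryGroupOfForm σ (!![0, 1; 1, 0] : Matrix (Fin 2) (Fin 2) E)), latt (((u : GL (Fin 2) E)) : Matrix (Fin 2) (Fin 2) E) = M)
    (γ τ : G) (hτ : τ * γ = γ * τ) :
    Nat.card (Quotient ((orbitRel (Subgroup.zpowers (⟨τ, Subgroup.mem_centralizer_singleton_iff.2 hτ⟩ : Subgroup.centralizer ({γ} : Set G))) (G ⧸ C)).comap
        (Subtype.val : ↥(fixedBy (G ⧸ C) γ) → G ⧸ C))) =
      Nat.card (Quotient ((orbitRel (Subgroup.zpowers (latticeTreePerm σ ϖ (!![0, 1; 1, 0] : Matrix (Fin 2) (Fin 2) E) (eU τ)))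
        {M : Submodule 𝒪[E] (Fin 2 → E) // IsSpecialLattice σ ϖ (!![0, 1; 1, 0] : Matrix (Fin 2) (Fin 2) E) M}).comap
        (Subtype.val : ↥{v : {M : Submodule 𝒪[E] (Fin 2 → E) // IsSpecialLattice σ ϖ (!![0, 1; 1, 0] : Matrix (Fin 2) (Fin 2) E) M} |
          latticeTreeIso σ ϖ (!![0, 1; 1, 0] : Matrix (Fin 2) (Fin 2) E) (eU γ) v = v ∧ IsSelfDualLattice σ (!![0, 1; 1, 0] : Matrix (Fin 2) (Fin 2) E) v.1} → _))) ∧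
    (Finite (Quotient ((orbitRel (Subgroup.zpowers (⟨τ, Subgroup.mem_centralizer_singleton_iff.2 hτ⟩ : Subgroup.centralizer ({γ} : Set G))) (G ⧸ C)).comap
        (Subtype.val : ↥(fixedBy (G ⧸ C) γ) → G ⧸ C))) ↔
      Finite (Quotient ((orbitRel (Subgroup.zpowers (latticeTreePerm σ ϖ (!![0, 1; 1, 0] : Matrix (Fin 2) (Fin 2) E) (eU τ)))
        {M : Submodule 𝒪[E] (Fin 2 → E) // IsSpecialLattice σ ϖ (!![0, 1; 1, 0] : Matrix (Fin 2) (Fin 2) E) M}).comap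
        (Subtype.val : ↥{v : {M : Submodule 𝒪[E] (Fin 2 → E) // IsSpecialLattice σ ϖ (!![0, 1; 1, 0] : Matrix (Fin 2) (Fin 2) E) M} |
          latticeTreeIso σ ϖ (!![0, 1; 1, 0] : Matrix (Fin 2) (Fin 2) E) (eU γ) v = v ∧ IsSelfDualLattice σ (!![0, 1; 1, 0] : Matrix (Fin 2) (Fin 2) E) v.1} → _)))) := by
  classical
  -- the coset transport along `eU` and the dictionary (A′)
  obtain ⟨Φ, hΦ⟩ := exists_equiv_fixedBy_quotient_congr C ((glInt 2 E).subgroupOf (unitaryGroupOfForm σ (!![0, 1; 1, 0] : Matrix (Fin 2) (Fin 2) E))) eU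
    (fun g => by rw [hC, Subgroup.mem_subgroupOf]) γ
  obtain ⟨d, hd⟩ := exists_equiv_fixedBy_fixed_selfDual_apply σ (ϖ := ϖ) (isUnimodular₂_antidiag (E := E)) hA (eU γ)
  refine natCard_quotient_orbitRel_fixedBy_eq_of_equivariant C γ τ hτ (latticeTreePerm σ ϖ (!![0, 1; 1, 0] : Matrix (Fin 2) (Fin 2) E) (eU τ)) (Φ.trans d)
    fun x x' n u hx hx' => ?_
  -- values of the dictionary at `x = uC` and `x′ = (τ^n u)C`
  have hxeq : x = ⟨(u : G ⧸ C), hx ▸ x.2⟩ := Subtype.ext hx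
  have hx'eq : x' = ⟨((τ ^ n * u : G) : G ⧸ C), hx' ▸ x'.2⟩ := Subtype.ext hx'
  have h1 := hd (Φ x) (eU u) (by rw [hxeq]; exact hΦ u _)
  have h2 := hd (Φ x') (eU (τ ^ n * u)) (by rw [hx'eq]; exact hΦ (τ ^ n * u) _)
  apply Subtype.ext
  change (((d (Φ x') : ↥{v : {M : Submodule 𝒪[E] (Fin 2 → E) // IsSpecialLattice σ ϖ (!![0, 1; 1, 0] : Matrix (Fin 2) (Fin 2) E) M} | _}) :
      {M : Submodule 𝒪[E] (Fin 2 → E) // IsSpecialLattice σ ϖ (!![0, 1; 1, 0] : Matrix (Fin 2) (Fin 2) E) M}) : Submodule 𝒪[E] (Fin 2 → E)) =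
    (((latticeTreePerm σ ϖ (!![0, 1; 1, 0] : Matrix (Fin 2) (Fin 2) E) (eU τ) ^ n) •
      ((d (Φ x) : ↥{v : {M : Submodule 𝒪[E] (Fin 2 → E) // IsSpecialLattice σ ϖ (!![0, 1; 1, 0] : Matrix (Fin 2) (Fin 2) E) M} | _}) :
        {M : Submodule 𝒪[E] (Fin 2 → E) // IsSpecialLattice σ ϖ (!![0, 1; 1, 0] : Matrix (Fin 2) (Fin 2) E) M}) :
        {M : Submodule 𝒪[E] (Fin 2 → E) // IsSpecialLattice σ ϖ (!![0, 1; 1, 0] : Matrix (Fin 2) (Fin 2) E) M}) : Submodule 𝒪[E] (Fin 2 → E))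
  rw [h2, latticeTreePerm_zpow_smul_coe_eq σ eU 1 τ u n _ (by rw [h1, mul_one]), mul_one]


/-- **LEVEL `K′ = U ∩ g₁ GL₂(𝒪) g₁⁻¹` (`ϖ`-modular vertices)**: on a model `eU : G ≃* U(Φ)` with `C ↔ g₁ GL₂(𝒪) g₁⁻¹`, the `τ^ℤ`-orbits on `Fix_γ(G ⧸ C)` are
equinumerous with the `(perm (eU τ))^ℤ`-orbits on the `eU γ`-fixed `ϖ`-modular vertices (★ (S6) dictionary (B′)), finiteness included.
[cite: Kottwitz1988, §2] [cite: Serre1980Trees, I.6.4, II.1.1] -/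
theorem natCard_quotient_orbitRel_fixedBy_eq_modular {g₁ : GL (Fin 2) E} (hg₁ : IsModularLattice σ ϖ (!![0, 1; 1, 0] : Matrix (Fin 2) (Fin 2) E) (latt (g₁ : Matrix (Fin 2) (Fin 2) E)))
    (CC : Subgroup G)
    (hC : ∀ g : G, g ∈ CC ↔ ((eU g : ↥(unitaryGroupOfForm σ (!![0, 1; 1, 0] : Matrix (Fin 2) (Fin 2) E))) : GL (Fin 2) E) ∈ (glInt 2 E).map (MulAut.conj g₁).toMonoidHom)
    (hB : ∀ M : Submodule 𝒪[E] (Fin 2 → E), IsModularLattice σ ϖ (!![0, 1; 1, 0] : Matrix (Fin 2) (Fin 2) E) M →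
      ∃ u : ↥(unitaryGroupOfForm σ (!![0, 1; 1, 0] : Matrix (Fin 2) (Fin 2) E)), latt (((u : GL (Fin 2) E) * g₁ : GL (Fin 2) E) : Matrix (Fin 2) (Fin 2) E) = M)
    (γ τ : G) (hτ : τ * γ = γ * τ) :
    Nat.card (Quotient ((orbitRel (Subgroup.zpowers (⟨τ, Subgroup.mem_centralizer_singleton_iff.2 hτ⟩ : Subgroup.centralizer ({γ} : Set G))) (G ⧸ CC)).comap
        (Subtype.val : ↥(fixedBy (G ⧸ CC) γ) → G ⧸ CC))) =
      Nat.card (Quotient ((orbitRel (Subgroup.zpowers (latticeTreePerm σ ϖ (!![0, 1; 1, 0] : Matrix (Fin 2) (Fin 2) E) (eU τ))) {M : Submodule 𝒪[E] (Fin 2 → E) // IsSpecialLattice σ ϖ (!![0, 1; 1, 0] : Matrix (Fin 2) (Fin 2) E) M}).comap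
        (Subtype.val : ↥{v : {M : Submodule 𝒪[E] (Fin 2 → E) // IsSpecialLattice σ ϖ (!![0, 1; 1, 0] : Matrix (Fin 2) (Fin 2) E) M} |
          latticeTreeIso σ ϖ (!![0, 1; 1, 0] : Matrix (Fin 2) (Fin 2) E) (eU γ) v = v ∧ IsModularLattice σ ϖ (!![0, 1; 1, 0] : Matrix (Fin 2) (Fin 2) E) v.1} → _))) ∧
    (Finite (Quotient ((orbitRel (Subgroup.zpowers (⟨τ, Subgroup.mem_centralizer_singleton_iff.2 hτ⟩ : Subgroup.centralizer ({γ} : Set G))) (G ⧸ CC)).comap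
        (Subtype.val : ↥(fixedBy (G ⧸ CC) γ) → G ⧸ CC))) ↔
      Finite (Quotient ((orbitRel (Subgroup.zpowers (latticeTreePerm σ ϖ (!![0, 1; 1, 0] : Matrix (Fin 2) (Fin 2) E) (eU τ))) {M : Submodule 𝒪[E] (Fin 2 → E) // IsSpecialLattice σ ϖ (!![0, 1; 1, 0] : Matrix (Fin 2) (Fin 2) E) M}).comap
        (Subtype.val : ↥{v : {M : Submodule 𝒪[E] (Fin 2 → E) // IsSpecialLattice σ ϖ (!![0, 1; 1, 0] : Matrix (Fin 2) (Fin 2) E) M} |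
          latticeTreeIso σ ϖ (!![0, 1; 1, 0] : Matrix (Fin 2) (Fin 2) E) (eU γ) v = v ∧ IsModularLattice σ ϖ (!![0, 1; 1, 0] : Matrix (Fin 2) (Fin 2) E) v.1} → _)))) := by
  classical
  obtain ⟨Φ, hΦ⟩ := exists_equiv_fixedBy_quotient_congr CC (((glInt 2 E).map (MulAut.conj g₁).toMonoidHom).subgroupOf (unitaryGroupOfForm σ (!![0, 1; 1, 0] : Matrix (Fin 2) (Fin 2) E))) eU
    (fun g => by rw [hC, Subgroup.mem_subgroupOf]) γ
  obtain ⟨d, hd⟩ := exists_equiv_fixedBy_fixed_modular_apply σ hg₁ hB (eU γ)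
  refine natCard_quotient_orbitRel_fixedBy_eq_of_equivariant CC γ τ hτ (latticeTreePerm σ ϖ (!![0, 1; 1, 0] : Matrix (Fin 2) (Fin 2) E) (eU τ)) (Φ.trans d)
    fun x x' n u hx hx' => ?_
  have hxeq : x = ⟨(u : G ⧸ CC), hx ▸ x.2⟩ := Subtype.ext hx
  have hx'eq : x' = ⟨((τ ^ n * u : G) : G ⧸ CC), hx' ▸ x'.2⟩ := Subtype.ext hx'
  have h1 := hd (Φ x) (eU u) (by rw [hxeq]; exact hΦ u _)
  have h2 := hd (Φ x') (eU (τ ^ n * u)) (by rw [hx'eq]; exact hΦ (τ ^ n * u) _)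
  apply Subtype.ext
  change (((d (Φ x') : ↥{v : {M : Submodule 𝒪[E] (Fin 2 → E) // IsSpecialLattice σ ϖ (!![0, 1; 1, 0] : Matrix (Fin 2) (Fin 2) E) M} | _}) : {M : Submodule 𝒪[E] (Fin 2 → E) // IsSpecialLattice σ ϖ (!![0, 1; 1, 0] : Matrix (Fin 2) (Fin 2) E) M}) : Submodule 𝒪[E] (Fin 2 → E)) =
    (((latticeTreePerm σ ϖ (!![0, 1; 1, 0] : Matrix (Fin 2) (Fin 2) E) (eU τ) ^ n) • ((d (Φ x) : ↥{v : {M : Submodule 𝒪[E] (Fin 2 → E) // IsSpecialLattice σ ϖ (!![0, 1; 1, 0] : Matrix (Fin 2) (Fin 2) E) M} | _}) : {M : Submodule 𝒪[E] (Fin 2 → E) // IsSpecialLattice σ ϖ (!![0, 1; 1, 0] : Matrix (Fin 2) (Fin 2) E) M}) : {M : Submodule 𝒪[E] (Fin 2 → E) // IsSpecialLattice σ ϖ (!![0, 1; 1, 0] : Matrix (Fin 2) (Fin 2) E) M}) : Submodule 𝒪[E] (Fin 2 → E))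
  rw [h2, latticeTreePerm_zpow_smul_coe_eq σ eU g₁ τ u n _ h1]

/-- **LEVEL `I = K ⊓ K′` (flags)**: on a model `eU : G ≃* U(Φ)` with `C = C_A ⊓ C_B`, the `τ^ℤ`-orbits on `Fix_γ(G ⧸ C)` are equinumerous with the
`(perm (eU τ))^ℤ`-orbits on the `eU γ`-fixed flags `(L self-dual, Λ ϖ-modular, ϖL ≤ Λ ≤ L)` (★ (S6) dictionary (I′)), finiteness included.
[cite: Kottwitz1988, §2] [cite: Serre1980Trees, I.6.4, II.1.1] -/
theorem natCard_quotient_orbitRel_fixedBy_eq_flags {g₁ : GL (Fin 2) E} (hg₁ : IsModularLattice σ ϖ (!![0, 1; 1, 0] : Matrix (Fin 2) (Fin 2) E) (latt (g₁ : Matrix (Fin 2) (Fin 2) E)))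
    (hadj₁ : scaleLattice ϖ (latt (1 : Matrix (Fin 2) (Fin 2) E)) ≤ latt (g₁ : Matrix (Fin 2) (Fin 2) E)) (hadj₂ : latt (g₁ : Matrix (Fin 2) (Fin 2) E) ≤ latt 1)
    (CA CB CC : Subgroup G)
    (hCA : ∀ g : G, g ∈ CA ↔ ((eU g : ↥(unitaryGroupOfForm σ (!![0, 1; 1, 0] : Matrix (Fin 2) (Fin 2) E))) : GL (Fin 2) E) ∈ glInt 2 E)
    (hCB : ∀ g : G, g ∈ CB ↔ ((eU g : ↥(unitaryGroupOfForm σ (!![0, 1; 1, 0] : Matrix (Fin 2) (Fin 2) E))) : GL (Fin 2) E) ∈ (glInt 2 E).map (MulAut.conj g₁).toMonoidHom)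
    (hC : ∀ g : G, g ∈ CC ↔ g ∈ CA ∧ g ∈ CB)
    (hI : ∀ M N : Submodule 𝒪[E] (Fin 2 → E), IsSelfDualLattice σ (!![0, 1; 1, 0] : Matrix (Fin 2) (Fin 2) E) M → IsModularLattice σ ϖ (!![0, 1; 1, 0] : Matrix (Fin 2) (Fin 2) E) N → scaleLattice ϖ M ≤ N → N ≤ M →
      ∃ u : ↥(unitaryGroupOfForm σ (!![0, 1; 1, 0] : Matrix (Fin 2) (Fin 2) E)), latt (((u : GL (Fin 2) E)) : Matrix (Fin 2) (Fin 2) E) = M ∧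
        latt (((u : GL (Fin 2) E) * g₁ : GL (Fin 2) E) : Matrix (Fin 2) (Fin 2) E) = N)
    (γ τ : G) (hτ : τ * γ = γ * τ) :
    Nat.card (Quotient ((orbitRel (Subgroup.zpowers (⟨τ, Subgroup.mem_centralizer_singleton_iff.2 hτ⟩ : Subgroup.centralizer ({γ} : Set G))) (G ⧸ CC)).comap
        (Subtype.val : ↥(fixedBy (G ⧸ CC) γ) → G ⧸ CC))) =
      Nat.card (Quotient ((orbitRel (Subgroup.zpowers (latticeTreePerm σ ϖ (!![0, 1; 1, 0] : Matrix (Fin 2) (Fin 2) E) (eU τ))) ({M : Submodule 𝒪[E] (Fin 2 → E) // IsSpecialLattice σ ϖ (!![0, 1; 1, 0] : Matrix (Fin 2) (Fin 2) E) M} × {M : Submodule 𝒪[E] (Fin 2 → E) // IsSpecialLattice σ ϖ (!![0, 1; 1, 0] : Matrix (Fin 2) (Fin 2) E) M})).comap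
        (Subtype.val : {p : {M : Submodule 𝒪[E] (Fin 2 → E) // IsSpecialLattice σ ϖ (!![0, 1; 1, 0] : Matrix (Fin 2) (Fin 2) E) M} × {M : Submodule 𝒪[E] (Fin 2 → E) // IsSpecialLattice σ ϖ (!![0, 1; 1, 0] : Matrix (Fin 2) (Fin 2) E) M} // IsSelfDualLattice σ (!![0, 1; 1, 0] : Matrix (Fin 2) (Fin 2) E) p.1.1 ∧ IsModularLattice σ ϖ (!![0, 1; 1, 0] : Matrix (Fin 2) (Fin 2) E) p.2.1 ∧ scaleLattice ϖ p.1.1 ≤ p.2.1 ∧ p.2.1 ≤ p.1.1 ∧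
          latticeTreeIso σ ϖ (!![0, 1; 1, 0] : Matrix (Fin 2) (Fin 2) E) (eU γ) p.1 = p.1 ∧ latticeTreeIso σ ϖ (!![0, 1; 1, 0] : Matrix (Fin 2) (Fin 2) E) (eU γ) p.2 = p.2} → _))) ∧
    (Finite (Quotient ((orbitRel (Subgroup.zpowers (⟨τ, Subgroup.mem_centralizer_singleton_iff.2 hτ⟩ : Subgroup.centralizer ({γ} : Set G))) (G ⧸ CC)).comap
        (Subtype.val : ↥(fixedBy (G ⧸ CC) γ) → G ⧸ CC))) ↔
      Finite (Quotient ((orbitRel (Subgroup.zpowers (latticeTreePerm σ ϖ (!![0, 1; 1, 0] : Matrix (Fin 2) (Fin 2) E) (eU τ))) ({M : Submodule 𝒪[E] (Fin 2 → E) // IsSpecialLattice σ ϖ (!![0, 1; 1, 0] : Matrix (Fin 2) (Fin 2) E) M} × {M : Submodule 𝒪[E] (Fin 2 → E) // IsSpecialLattice σ ϖ (!![0, 1; 1, 0] : Matrix (Fin 2) (Fin 2) E) M})).comap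
        (Subtype.val : {p : {M : Submodule 𝒪[E] (Fin 2 → E) // IsSpecialLattice σ ϖ (!![0, 1; 1, 0] : Matrix (Fin 2) (Fin 2) E) M} × {M : Submodule 𝒪[E] (Fin 2 → E) // IsSpecialLattice σ ϖ (!![0, 1; 1, 0] : Matrix (Fin 2) (Fin 2) E) M} // IsSelfDualLattice σ (!![0, 1; 1, 0] : Matrix (Fin 2) (Fin 2) E) p.1.1 ∧ IsModularLattice σ ϖ (!![0, 1; 1, 0] : Matrix (Fin 2) (Fin 2) E) p.2.1 ∧ scaleLattice ϖ p.1.1 ≤ p.2.1 ∧ p.2.1 ≤ p.1.1 ∧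
          latticeTreeIso σ ϖ (!![0, 1; 1, 0] : Matrix (Fin 2) (Fin 2) E) (eU γ) p.1 = p.1 ∧ latticeTreeIso σ ϖ (!![0, 1; 1, 0] : Matrix (Fin 2) (Fin 2) E) (eU γ) p.2 = p.2} → _)))) := by
  classical
  obtain ⟨Φ, hΦ⟩ := exists_equiv_fixedBy_quotient_congr CC
    ((glInt 2 E).subgroupOf (unitaryGroupOfForm σ (!![0, 1; 1, 0] : Matrix (Fin 2) (Fin 2) E)) ⊓ ((glInt 2 E).map (MulAut.conj g₁).toMonoidHom).subgroupOf (unitaryGroupOfForm σ (!![0, 1; 1, 0] : Matrix (Fin 2) (Fin 2) E))) eU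
    (fun g => by rw [hC, Subgroup.mem_inf, Subgroup.mem_subgroupOf, Subgroup.mem_subgroupOf, hCA, hCB]) γ
  obtain ⟨d, hd⟩ := exists_equiv_fixedBy_inf_fixed_flags_apply σ (isUnimodular₂_antidiag (E := E)) hg₁ hadj₁ hadj₂ hI (eU γ)
  refine natCard_quotient_orbitRel_fixedBy_eq_of_equivariant CC γ τ hτ (latticeTreePerm σ ϖ (!![0, 1; 1, 0] : Matrix (Fin 2) (Fin 2) E) (eU τ)) (Φ.trans d)
    fun x x' n u hx hx' => ?_
  have hxeq : x = ⟨(u : G ⧸ CC), hx ▸ x.2⟩ := Subtype.ext hx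
  have hx'eq : x' = ⟨((τ ^ n * u : G) : G ⧸ CC), hx' ▸ x'.2⟩ := Subtype.ext hx'
  obtain ⟨h1a, h1b⟩ := hd (Φ x) (eU u) (by rw [hxeq]; exact hΦ u _)
  obtain ⟨h2a, h2b⟩ := hd (Φ x') (eU (τ ^ n * u)) (by rw [hx'eq]; exact hΦ (τ ^ n * u) _)
  change ((d (Φ x') : {p : {M : Submodule 𝒪[E] (Fin 2 → E) // IsSpecialLattice σ ϖ (!![0, 1; 1, 0] : Matrix (Fin 2) (Fin 2) E) M} × {M : Submodule 𝒪[E] (Fin 2 → E) // IsSpecialLattice σ ϖ (!![0, 1; 1, 0] : Matrix (Fin 2) (Fin 2) E) M} // _}) : {M : Submodule 𝒪[E] (Fin 2 → E) // IsSpecialLattice σ ϖ (!![0, 1; 1, 0] : Matrix (Fin 2) (Fin 2) E) M} × {M : Submodule 𝒪[E] (Fin 2 → E) // IsSpecialLattice σ ϖ (!![0, 1; 1, 0] : Matrix (Fin 2) (Fin 2) E) M}) =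
    (latticeTreePerm σ ϖ (!![0, 1; 1, 0] : Matrix (Fin 2) (Fin 2) E) (eU τ) ^ n) • ((d (Φ x) : {p : {M : Submodule 𝒪[E] (Fin 2 → E) // IsSpecialLattice σ ϖ (!![0, 1; 1, 0] : Matrix (Fin 2) (Fin 2) E) M} × {M : Submodule 𝒪[E] (Fin 2 → E) // IsSpecialLattice σ ϖ (!![0, 1; 1, 0] : Matrix (Fin 2) (Fin 2) E) M} // _}) : {M : Submodule 𝒪[E] (Fin 2 → E) // IsSpecialLattice σ ϖ (!![0, 1; 1, 0] : Matrix (Fin 2) (Fin 2) E) M} × {M : Submodule 𝒪[E] (Fin 2 → E) // IsSpecialLattice σ ϖ (!![0, 1; 1, 0] : Matrix (Fin 2) (Fin 2) E) M})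
  refine Prod.ext (Subtype.ext ?_) (Subtype.ext ?_)
  · rw [Prod.smul_fst, h2a, latticeTreePerm_zpow_smul_coe_eq σ eU 1 τ u n _ (by rw [h1a, mul_one]), mul_one]
  · rw [Prod.smul_snd, h2b, latticeTreePerm_zpow_smul_coe_eq σ eU g₁ τ u n _ h1b]


include hσv hϖ in
/-- **PER PERIOD, `#Fix(G⧸K) + #Fix(G⧸K′) = #Fix(G⧸(K ⊓ K′))` AT A DIAGONAL TORUS ELEMENT** — the coset side of ★ (S7b).  On a model `eU : G ≃* U(Φ)` over a
discretely valued field (`σ` valuation-preserving, `ϖ` uniformizing) with levels `C_A ↔ GL₂(𝒪)`, `C_B ↔ g₁ GL₂(𝒪) g₁⁻¹`, `C_I = C_A ⊓ C_B` (`latt g₁` the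
`ϖ`-modular base vertex, `ϖ𝒪² ≤ latt g₁ ≤ 𝒪²`) and the three transitivities (hA)(hB)(hI): for `γ ∈ G` with `eU γ` DIAGONAL with UNIT entries and `τ ∈ G` commuting
with `γ` with `eU τ = diag(ϖ, (σϖ)⁻¹)`, if the three per-period quotients are finite then
`#(Fix_γ(G⧸C_A)∕τ^ℤ) + #(Fix_γ(G⧸C_B)∕τ^ℤ) = #(Fix_γ(G⧸C_I)∕τ^ℤ)`.  With ★ `classOrbitalIntegral_indicator_complex_eq_mul_natCard_quotient_zpowers` (×3) this is
Kottwitz's non-elliptic relation (N) at `(C_A, C_B, C_I)`. [cite: Kottwitz1988, §2 Theorem 2] [cite: Serre1980Trees, I.6.4 Prop. 24–25; II.1.1] [cite: Laumon1995, Lemma (5.3.2)] -/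
theorem natCard_quotient_fixedBy_add_eq_natCard_quotient_fixedBy_inf [IsDiscreteValuationRing 𝒪[E]]
    {g₁ : GL (Fin 2) E} (hg₁ : IsModularLattice σ ϖ (!![0, 1; 1, 0] : Matrix (Fin 2) (Fin 2) E) (latt (g₁ : Matrix (Fin 2) (Fin 2) E)))
    (hadj₁ : scaleLattice ϖ (latt (1 : Matrix (Fin 2) (Fin 2) E)) ≤ latt (g₁ : Matrix (Fin 2) (Fin 2) E)) (hadj₂ : latt (g₁ : Matrix (Fin 2) (Fin 2) E) ≤ latt 1)
    (CA CB CI : Subgroup G)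
    (hCA : ∀ g : G, g ∈ CA ↔ ((eU g : ↥(unitaryGroupOfForm σ (!![0, 1; 1, 0] : Matrix (Fin 2) (Fin 2) E))) : GL (Fin 2) E) ∈ glInt 2 E)
    (hCB : ∀ g : G, g ∈ CB ↔ ((eU g : ↥(unitaryGroupOfForm σ (!![0, 1; 1, 0] : Matrix (Fin 2) (Fin 2) E))) : GL (Fin 2) E) ∈ (glInt 2 E).map (MulAut.conj g₁).toMonoidHom)
    (hCI : ∀ g : G, g ∈ CI ↔ g ∈ CA ∧ g ∈ CB)
    (hA : ∀ M : Submodule 𝒪[E] (Fin 2 → E), IsSelfDualLattice σ (!![0, 1; 1, 0] : Matrix (Fin 2) (Fin 2) E) M →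
      ∃ u : ↥(unitaryGroupOfForm σ (!![0, 1; 1, 0] : Matrix (Fin 2) (Fin 2) E)), latt (((u : GL (Fin 2) E)) : Matrix (Fin 2) (Fin 2) E) = M)
    (hB : ∀ M : Submodule 𝒪[E] (Fin 2 → E), IsModularLattice σ ϖ (!![0, 1; 1, 0] : Matrix (Fin 2) (Fin 2) E) M →
      ∃ u : ↥(unitaryGroupOfForm σ (!![0, 1; 1, 0] : Matrix (Fin 2) (Fin 2) E)), latt (((u : GL (Fin 2) E) * g₁ : GL (Fin 2) E) : Matrix (Fin 2) (Fin 2) E) = M)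
    (hI : ∀ M N : Submodule 𝒪[E] (Fin 2 → E), IsSelfDualLattice σ (!![0, 1; 1, 0] : Matrix (Fin 2) (Fin 2) E) M → IsModularLattice σ ϖ (!![0, 1; 1, 0] : Matrix (Fin 2) (Fin 2) E) N → scaleLattice ϖ M ≤ N → N ≤ M →
      ∃ u : ↥(unitaryGroupOfForm σ (!![0, 1; 1, 0] : Matrix (Fin 2) (Fin 2) E)), latt (((u : GL (Fin 2) E)) : Matrix (Fin 2) (Fin 2) E) = M ∧
        latt (((u : GL (Fin 2) E) * g₁ : GL (Fin 2) E) : Matrix (Fin 2) (Fin 2) E) = N)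
    (γ τ : G) (hτ : τ * γ = γ * τ)
    (ht : (((eU τ : ↥(unitaryGroupOfForm σ (!![0, 1; 1, 0] : Matrix (Fin 2) (Fin 2) E))) : GL (Fin 2) E) : Matrix (Fin 2) (Fin 2) E) = Matrix.diagonal ![ϖ, (σ ϖ)⁻¹])
    {e : Fin 2 → E} (hγ : (((eU γ : ↥(unitaryGroupOfForm σ (!![0, 1; 1, 0] : Matrix (Fin 2) (Fin 2) E))) : GL (Fin 2) E) : Matrix (Fin 2) (Fin 2) E) = Matrix.diagonal e) (he : ∀ i, valuation E (e i) = 1)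
    (hfinA : Finite (Quotient ((orbitRel (Subgroup.zpowers (⟨τ, Subgroup.mem_centralizer_singleton_iff.2 hτ⟩ : Subgroup.centralizer ({γ} : Set G))) (G ⧸ CA)).comap
        (Subtype.val : ↥(fixedBy (G ⧸ CA) γ) → G ⧸ CA))))
    (hfinB : Finite (Quotient ((orbitRel (Subgroup.zpowers (⟨τ, Subgroup.mem_centralizer_singleton_iff.2 hτ⟩ : Subgroup.centralizer ({γ} : Set G))) (G ⧸ CB)).comap
        (Subtype.val : ↥(fixedBy (G ⧸ CB) γ) → G ⧸ CB))))
    (hfinI : Finite (Quotient ((orbitRel (Subgroup.zpowers (⟨τ, Subgroup.mem_centralizer_singleton_iff.2 hτ⟩ : Subgroup.centralizer ({γ} : Set G))) (G ⧸ CI)).comap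
        (Subtype.val : ↥(fixedBy (G ⧸ CI) γ) → G ⧸ CI)))) :
    Nat.card (Quotient ((orbitRel (Subgroup.zpowers (⟨τ, Subgroup.mem_centralizer_singleton_iff.2 hτ⟩ : Subgroup.centralizer ({γ} : Set G))) (G ⧸ CA)).comap
        (Subtype.val : ↥(fixedBy (G ⧸ CA) γ) → G ⧸ CA))) +
        Nat.card (Quotient ((orbitRel (Subgroup.zpowers (⟨τ, Subgroup.mem_centralizer_singleton_iff.2 hτ⟩ : Subgroup.centralizer ({γ} : Set G))) (G ⧸ CB)).comap
        (Subtype.val : ↥(fixedBy (G ⧸ CB) γ) → G ⧸ CB))) =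
      Nat.card (Quotient ((orbitRel (Subgroup.zpowers (⟨τ, Subgroup.mem_centralizer_singleton_iff.2 hτ⟩ : Subgroup.centralizer ({γ} : Set G))) (G ⧸ CI)).comap
        (Subtype.val : ↥(fixedBy (G ⧸ CI) γ) → G ⧸ CI))) := by
  obtain ⟨hAeq, hAfin⟩ := natCard_quotient_orbitRel_fixedBy_eq_selfDual σ eU CA hCA hA γ τ hτ
  obtain ⟨hBeq, hBfin⟩ := natCard_quotient_orbitRel_fixedBy_eq_modular σ eU hg₁ CB hCB hB γ τ hτ
  obtain ⟨hIeq, hIfin⟩ := natCard_quotient_orbitRel_fixedBy_eq_flags σ eU hg₁ hadj₁ hadj₂ CA CB CI hCA hCB hCI hI γ τ hτ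
  rw [hAeq, hBeq, hIeq]
  exact natCard_quotient_fixed_add_eq_natCard_quotient_fixedFlags' σ hσv hϖ ht hγ he (hAfin.1 hfinA) (hBfin.1 hfinB) (hIfin.1 hfinI)

end Levels

end Literature.NumberTheory.Automorphic.HermitianLatticeTree

end
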